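import Literature.NumberTheory.ConnesConsani2023.ZetaCyclesProofs
import Literature.NumberTheory.ConnesConsani2023.ZetaCyclesRotations
import Literature.NumberTheory.ConnesConsani2023.ZetaCyclesRiemannSums
import HarnessLib

/-!
# ζ-cycles: Lemma 6.2 (iii) of Connes–Consani 2023 (the closure of `Σ_μ 𝓔(𝒮^ev_0)`)

RH-FREE corpus literature (Connes–Consani 2023, *Spectral triples and ζ-cycles*, §6; cell rh-crit C1,
row t11).  Sequel of `ZetaCyclesProofs.lean` (Theorem 6.4), `ZetaCyclesRotations.lean` (Peter–Weyl on the
circle) and `ZetaCyclesRiemannSums.lean` (Lemma 6.1).  Everything here is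
PROVED; no new named facts.  This file DISCHARGES `CC2023_lemma_6_2_iii` of `ZetaCycles.lean`, the last of
that file's named facts.  Nothing in this file bears on the truth of RH.

Lemma 6.2 (iii) (arXiv:2106.01715, p0018:L69): for `f` as in Lemma 6.1 which coincides near `0` with a
smooth even function, `Σ_μ 𝓔(f)` lies in the closure of `Σ_μ 𝓔(𝒮^ev_0)` in `L²(C_μ)`.  The printed proof
approximates by `ϑ(ρ̃) f ∈ 𝒮^ev_0` using the continuity of the regular representation.  Here a different
(shorter, in the presence of Theorem 6.4) road is taken, which does not even use the extra hypothesis: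
the closure of `Σ_μ 𝓔(𝒮^ev_0)` is `𝓗(L)^⊥`; by Peter–Weyl (`inner_fourierLp_eq_zero_of_not_mem`) a vector of
`𝓗(L)` only has Fourier coefficients along the characters `e_n ∈ 𝓗(L)`, i.e. (Theorem 6.4 (i)) those with
`ζ(½ + i s_n) = 0`, `s_n = 2πn/L`; and by Müntz's formula for bounded-variation data (proved here from
Lemma 6.1's bounds) the `n`-th Fourier coefficient of `Σ_μ 𝓔(f)` is `L⁻¹ conj(ζ(½ + i s_n) 𝓜f(½ + i s_n))`,
which vanishes for those `n`.  Hence `Σ_μ 𝓔(f) ⊥ 𝓗(L)`.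

## References

* A. Connes, C. Consani, *Spectral triples and ζ-cycles*, Enseign. Math. 69 (2023) 93–148,
  arXiv:2106.01715, §6, Lemma 6.1, Lemma 6.2, Theorem 6.4 [ConnesConsani2023].
-/

noncomputable section

open scoped Topology ENNReal NNReal ComplexConjugate
open Function Filter MeasureTheory Set Asymptotics Complex AddCircle
open Literature.NumberTheory.LFunctions

namespace Literature.NumberTheory.ConnesConsani2023.ZetaCycles

namespace RiemannSumHyp

variable {f : ℝ → ℝ}

/-! ### Müntz's formula for bounded-variation data -/

/-- Decay of the sums: `|Σ_{n≥1} f(nu)| ≤ C/u^N` for `u ≥ X`. [cite: ConnesConsani2023, Lemma 6.1 (i), proof (arXiv chunk p0018:L51–L57)] -/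
theorem exists_abs_tsum_le_div_pow (hf : RiemannSumHyp f) (N : ℕ) :
    ∃ C X : ℝ, 0 ≤ C ∧ 1 ≤ X ∧ ∀ u, X ≤ u → |∑' n : ℕ, f (((n + 1 : ℕ) : ℝ) * u)| ≤ C / u ^ N := by
  obtain ⟨C, X, hC0, hX1, hb⟩ := hf.exists_abs_connesE_le_div_pow N
  refine ⟨C, X, hC0, hX1, fun u hu => ?_⟩
  have hu1 : 1 ≤ u := le_trans hX1 hu
  have hu0 : 0 < u := lt_of_lt_of_le zero_lt_one hu1
  have hsq : 1 ≤ Real.sqrt u := by rw [← Real.sqrt_one]; exact Real.sqrt_le_sqrt hu1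
  have h := hb u hu
  rw [connesE, abs_mul, abs_of_nonneg (Real.sqrt_nonneg u)] at h
  calc |∑' n : ℕ, f (((n + 1 : ℕ) : ℝ) * u)| ≤ Real.sqrt u * |∑' n : ℕ, f (((n + 1 : ℕ) : ℝ) * u)| :=
        le_mul_of_one_le_left (abs_nonneg _) hsq
    _ ≤ C / u ^ N := h

/-- `f` is bounded on `(0,∞)` (bounded variation): `|f x| ≤ |f 1| + Var(f; (0,∞))`. [folklore] -/
private theorem abs_le_of_bv (hf : RiemannSumHyp f) {x : ℝ} (hx : 0 < x) :
    |f x| ≤ |f 1| + (eVariationOn f (Ioi 0)).toReal := by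
  have h1 : (1 : ℝ) ∈ Ioi 0 := Set.mem_Ioi.2 zero_lt_one
  have h := hf.bv.sub_le hx h1
  have h' := hf.bv.sub_le h1 hx
  rw [abs_le]
  constructor
  · linarith [neg_abs_le (f 1)]
  · linarith [le_abs_self (f 1)]

/-- For `p` monotone on `(0,∞)` and `c > 0`, `x ↦ p(c eˣ)` is measurable. [folklore] -/
private theorem measurable_comp_mul_exp_of_monotoneOn' {p : ℝ → ℝ} (hp : MonotoneOn p (Ioi 0)) {c : ℝ}
    (hc : 0 < c) : Measurable fun x : ℝ => p (c * Real.exp x) := by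
  refine Monotone.measurable fun x y hxy => hp ?_ ?_ ?_
  · exact mul_pos hc (Real.exp_pos x)
  · exact mul_pos hc (Real.exp_pos y)
  · exact mul_le_mul_of_nonneg_left (Real.exp_le_exp.2 hxy) hc.le

/-- `x ↦ Σ_{n≥1} f((n+1) eˣ)` is measurable. [folklore] -/
private theorem measurable_tsum_comp_exp (hf : RiemannSumHyp f) :
    Measurable fun x : ℝ => ∑' n : ℕ, f (((n + 1 : ℕ) : ℝ) * Real.exp x) := by
  obtain ⟨p, q, hp, hq, hfpq⟩ := hf.bv.locallyBoundedVariationOn.exists_monotoneOn_sub_monotoneOn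
  refine measurable_of_tendsto_metrizable
    (f := fun N x => ∑ n ∈ Finset.range N, f (((n + 1 : ℕ) : ℝ) * Real.exp x)) ?_ ?_
  · intro N
    refine Finset.measurable_sum _ fun n _ => ?_
    have h : (fun x => f (((n + 1 : ℕ) : ℝ) * Real.exp x)) =
        fun x => p (((n + 1 : ℕ) : ℝ) * Real.exp x) - q (((n + 1 : ℕ) : ℝ) * Real.exp x) := by
      funext x; rw [hfpq]; rfl
    rw [h]
    exact (measurable_comp_mul_exp_of_monotoneOn' hp (by positivity)).sub
      (measurable_comp_mul_exp_of_monotoneOn' hq (by positivity))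
  · rw [tendsto_pi_nhds]
    intro x
    exact (hf.summable_comp_mul (Real.exp_pos x)).hasSum.tendsto_sum_nat

/-- **Müntz's formula for the data of Lemma 6.1**: with `G(x) = Σ_{n≥1} f(nx)`, for `0 < Re s < 2`,
`s ≠ 1`, the Mellin transform of `G` converges absolutely and `𝓜G(s) = ζ(s) 𝓜f(s)` (`G` is bounded by the
Riemann-sum estimate and `O(x^{-2})` at `∞`; the tree's continuation `mellin_tsum_comp_mul_nat_of_isBigO`
applies with `b = 0`). [cite: ConnesConsani2023, proof of Theorem 6.4, eq. (𝓔 ζ) (arXiv chunk p0019:L52–L89)] -/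
theorem mellin_tsum_comp_mul (hf : RiemannSumHyp f) {s : ℂ} (hs : 0 < s.re) (hs2 : s.re < 2)
    (hs1 : s ≠ 1) :
    MellinConvergent (fun x : ℝ => ∑' n : ℕ, ((f (((n + 1 : ℕ) : ℝ) * x) : ℝ) : ℂ)) s ∧
      mellin (fun x : ℝ => ∑' n : ℕ, ((f (((n + 1 : ℕ) : ℝ) * x) : ℝ) : ℂ)) s =
        riemannZeta s * mellin (fun x => ((f x : ℝ) : ℂ)) s := by
  set F : ℝ → ℂ := fun x => ((f x : ℝ) : ℂ) with hF
  have hGeq : (fun x : ℝ => ∑' n : ℕ, ((f (((n + 1 : ℕ) : ℝ) * x) : ℝ) : ℂ)) =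
      fun x => ∑' n : ℕ, F (((n + 1 : ℕ) : ℝ) * x) := rfl
  set V : ℝ := (eVariationOn f (Ioi 0)).toReal with hV
  -- hypotheses on `F`
  have hFi : IntegrableOn F (Ioi 0) := by
    rw [hF]; exact hf.integrable.ofReal
  have hF_int : LocallyIntegrableOn F (Ioi 0) := hFi.locallyIntegrableOn
  have hF_top : F =O[atTop] fun x : ℝ => x ^ (-(2 : ℝ)) := by
    have h := hf.decay 2
    rw [hF, Complex.isBigO_ofReal_left]
    simpa using h
  have hF_bot : F =O[𝓝[>] (0 : ℝ)] fun x : ℝ => x ^ (-(0 : ℝ)) := by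
    refine IsBigO.of_bound (|f 1| + V) ?_
    filter_upwards [self_mem_nhdsWithin] with x hx
    rw [hF, Complex.norm_real, Real.norm_eq_abs, neg_zero, Real.rpow_zero, norm_one, mul_one]
    exact hf.abs_le_of_bv hx
  -- the sum `G`, as a complex function
  have hGre : ∀ x : ℝ, ∑' n : ℕ, F (((n + 1 : ℕ) : ℝ) * x) =
      ((∑' n : ℕ, f (((n + 1 : ℕ) : ℝ) * x) : ℝ) : ℂ) := fun x => by
    rw [hF]; exact (Complex.ofReal_tsum _).symm
  have hG_norm : ∀ x : ℝ, 0 < x → ‖∑' n : ℕ, F (((n + 1 : ℕ) : ℝ) * x)‖ ≤ V := fun x hx => by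
    rw [hGre, Complex.norm_real, Real.norm_eq_abs]; exact hf.abs_tsum_le hx
  have hG_meas : Measurable fun x : ℝ => ∑' n : ℕ, F (((n + 1 : ℕ) : ℝ) * Real.exp x) := by
    have h : (fun x : ℝ => ∑' n : ℕ, F (((n + 1 : ℕ) : ℝ) * Real.exp x)) =
        fun x => ((∑' n : ℕ, f (((n + 1 : ℕ) : ℝ) * Real.exp x) : ℝ) : ℂ) := funext fun x => hGre _
    rw [h]
    exact Complex.measurable_ofReal.comp hf.measurable_tsum_comp_exp
  -- measurability of `G` on `(0, ∞)` through `x = log u`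
  have hG_aemeas : AEStronglyMeasurable (fun x : ℝ => ∑' n : ℕ, F (((n + 1 : ℕ) : ℝ) * x))
      (volume.restrict (Ioi 0)) := by
    have hm : Measurable fun u : ℝ => ∑' n : ℕ, F (((n + 1 : ℕ) : ℝ) * Real.exp (Real.log u)) :=
      hG_meas.comp Real.measurable_log
    refine (hm.aestronglyMeasurable.congr ?_)
    filter_upwards [ae_restrict_mem measurableSet_Ioi] with u hu
    rw [Real.exp_log hu]
  have hG_int : LocallyIntegrableOn (fun x : ℝ => ∑' n : ℕ, F (((n + 1 : ℕ) : ℝ) * x)) (Ioi 0) := by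
    rw [locallyIntegrableOn_iff isOpen_Ioi.isLocallyClosed]
    intro K hK hKc
    refine IntegrableOn.of_bound hKc.measure_lt_top (hG_aemeas.mono_measure (Measure.restrict_mono hK le_rfl))
      V ?_
    filter_upwards [ae_restrict_mem hKc.measurableSet] with x hx
    exact hG_norm x (hK hx)
  have hG_top : (fun x : ℝ => ∑' n : ℕ, F (((n + 1 : ℕ) : ℝ) * x)) =O[atTop] fun x : ℝ => x ^ (-(2 : ℝ)) := by
    obtain ⟨C, X, hC0, hX1, hb⟩ := hf.exists_abs_tsum_le_div_pow 2
    refine IsBigO.of_bound C ?_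
    filter_upwards [eventually_ge_atTop X] with x hx
    have hx0 : 0 < x := lt_of_lt_of_le zero_lt_one (le_trans hX1 hx)
    rw [hGre, Complex.norm_real, Real.norm_eq_abs, Real.norm_of_nonneg (Real.rpow_nonneg hx0.le _),
      Real.rpow_neg hx0.le, show (2 : ℝ) = ((2 : ℕ) : ℝ) by norm_num, Real.rpow_natCast, ← div_eq_mul_inv]
    exact hb x hx
  have hG_bot : (fun x : ℝ => ∑' n : ℕ, F (((n + 1 : ℕ) : ℝ) * x)) =O[𝓝[>] (0 : ℝ)]
      fun x : ℝ => x ^ (-(0 : ℝ)) := by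
    refine IsBigO.of_bound V ?_
    filter_upwards [self_mem_nhdsWithin] with x hx
    rw [neg_zero, Real.rpow_zero, norm_one, mul_one]
    exact hG_norm x hx
  refine ⟨mellinConvergent_of_isBigO_rpow hG_int hG_top hs2 hG_bot (by simpa using hs), ?_⟩
  exact mellin_tsum_comp_mul_nat_of_isBigO one_lt_two hF_int hF_top hF_bot hG_int hG_top hG_bot
    (by simpa using hs) hs2 hs1

/-- **Eq. (𝓔 ζ) for the data of Lemma 6.1**: for `−½ < Re s < 3/2`, `s ≠ ½`, the Mellin transform of
`𝓔(f)` converges absolutely at `s` and `∫_0^∞ 𝓔(f)(u) u^{s-1} du = ζ(s + ½) ∫_0^∞ f(x) x^{s-½} dx`.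
[cite: ConnesConsani2023, proof of Theorem 6.4, eq. (𝓔 ζ) (arXiv chunk p0019:L52–L89)] -/
theorem mellin_connesE (hf : RiemannSumHyp f) {s : ℂ} (hs : -(1 / 2 : ℝ) < s.re) (hs2 : s.re < 3 / 2)
    (hs1 : s ≠ 1 / 2) :
    MellinConvergent (fun u ↦ (connesE f u : ℂ)) s ∧
      mellin (fun u ↦ (connesE f u : ℂ)) s =
        riemannZeta (s + 1 / 2) * mellin (fun x ↦ ((f x : ℝ) : ℂ)) (s + 1 / 2) := by
  have hs' : 0 < (s + 1 / 2).re := by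
    simp only [add_re, one_div]; norm_num; linarith
  have hs2' : (s + 1 / 2).re < 2 := by
    simp only [add_re, one_div]; norm_num; linarith
  have hs1' : s + 1 / 2 ≠ 1 := by
    intro h; apply hs1; linear_combination h
  obtain ⟨hconv, heq⟩ := hf.mellin_tsum_comp_mul hs' hs2' hs1'
  have hEq : EqOn (fun u : ℝ ↦ (connesE f u : ℂ))
      (fun u ↦ (u : ℂ) ^ ((1 / 2 : ℂ)) • ∑' n : ℕ, ((f (((n + 1 : ℕ) : ℝ) * u) : ℝ) : ℂ)) (Ioi 0) :=
    fun u hu ↦ connesE_ofReal_eq hu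
  refine ⟨?_, ?_⟩
  · have h1 : MellinConvergent
        (fun u : ℝ ↦ (u : ℂ) ^ ((1 / 2 : ℂ)) • ∑' n : ℕ, ((f (((n + 1 : ℕ) : ℝ) * u) : ℝ) : ℂ)) s :=
      MellinConvergent.cpow_smul.mpr hconv
    rw [MellinConvergent] at h1 ⊢
    refine (integrableOn_congr_fun ?_ measurableSet_Ioi).mpr h1
    intro u hu
    simp only [hEq hu]
  · rw [← heq, ← mellin_cpow_smul]
    exact setIntegral_congr_fun measurableSet_Ioi fun u hu ↦ by simp only [hEq hu]

/-! ### `Σ_μ 𝓔(f)` as an element of `L²(C)` and its Fourier coefficients -/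

/-- `Σ_μ 𝓔(f)` is bounded and measurable on the circle (Lemma 6.1 (ii)), hence in `L²(C)`.
[cite: ConnesConsani2023, Lemma 6.1 (ii) (arXiv chunk p0018:L24)] -/
theorem memLp_sigmaE (hf : RiemannSumHyp f) {L : ℝ} [hL : Fact (0 < L)] :
    MemLp (sigmaE L f) 2 (@haarAddCircle L hL) := by
  obtain ⟨C, hC⟩ := hf.exists_abs_scaleSum_le hL.out
  refine MemLp.of_bound (hf.measurable_sigmaE hL.out).aestronglyMeasurable C (Eventually.of_forall fun y => ?_)
  induction y using QuotientAddGroup.induction_on with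
  | H x =>
    rw [sigmaE_coe, Complex.norm_real, Real.norm_eq_abs]
    exact hC _ (Real.exp_pos x)

/-- The Fourier coefficients of `Σ_μ 𝓔(f)`: for `sL = 2πn` and `ξ` a.e. equal to `Σ_μ 𝓔(f)`,
`⟪e_n, ξ⟫ = L⁻¹ conj(ζ(½ + is) 𝓜f(½ + is))`. [cite: ConnesConsani2023, proof of Theorem 6.4 (arXiv chunk p0019:L39, L85–L94)] -/
theorem inner_fourierLp_eq (hf : RiemannSumHyp f) {L : ℝ} [hL : Fact (0 < L)]
    {ξ : Lp ℂ 2 (@haarAddCircle L hL)} (hξ : (ξ : AddCircle L → ℂ) =ᵐ[haarAddCircle] sigmaE L f)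
    {s : ℝ} {n : ℤ} (hsL : s * L = 2 * Real.pi * n) :
    inner ℂ (fourierLp 2 n : Lp ℂ 2 (@haarAddCircle L hL)) ξ =
      (L⁻¹ : ℝ) • conj (riemannZeta (1 / 2 + s * I) *
        mellin (fun x => ((f x : ℝ) : ℂ)) (1 / 2 + s * I)) := by
  have h0 := hf.mellin_connesE (s := 0) (by norm_num) (by norm_num) (by norm_num)
  have hs := hf.mellin_connesE (s := I * s) (by simp) (by simp) (by
    intro h
    have := congrArg Complex.re h
    simp at this)
  have harg : I * (s : ℂ) + 1 / 2 = 1 / 2 + (s : ℂ) * I := by ring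
  rw [inner_fourierLp_eq_mellin (integrable_connesE_comp_exp h0.1) hξ hsL, hs.2, harg]

end RiemannSumHyp

/-! ### Lemma 6.2 (iii) -/

/-- **Lemma 6.2 (iii)** (discharge of `CC2023_lemma_6_2_iii`): for `f` as in Lemma 6.1 (coinciding near
`0` with a smooth even function — a hypothesis not needed in this proof), `Σ_μ 𝓔(f)` belongs to the
closure of `Σ_μ 𝓔(𝒮^ev_0)` in `L²(C_μ)`.  Proof (see the module docstring): the closure is `𝓗(L)^⊥`, and
`Σ_μ 𝓔(f)` is orthogonal to `𝓗(L)` because its Fourier coefficients vanish along the characters of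
`𝓗(L)` (Theorem 6.4 (i) and eq. (𝓔 ζ)) while vectors of `𝓗(L)` have no other Fourier coefficients
(Peter–Weyl).  RH-FREE; nothing here bears on the truth of RH.
[cite: ConnesConsani2023, Lemma 6.2 (iii) (arXiv chunk p0018:L69)] -/
theorem CC2023_lemma_6_2_iii_holds : CC2023_lemma_6_2_iii := by
  intro L hL f hf _hsmooth
  set ξ : Lp ℂ 2 (@haarAddCircle L hL) := (hf.memLp_sigmaE (L := L)).toLp (sigmaE L f) with hξdef
  have hξ : (ξ : AddCircle L → ℂ) =ᵐ[haarAddCircle] sigmaE L f := MemLp.coeFn_toLp _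
  refine ⟨ξ, ?_, hξ⟩
  haveI : (zetaCycleSpace L).HasOrthogonalProjection := by
    unfold zetaCycleSpace; infer_instance
  rw [← Submodule.orthogonal_orthogonal_eq_closure]
  change ξ ∈ (zetaCycleSpace L)ᗮ
  rw [Submodule.mem_orthogonal]
  intro v hv
  -- invariance of `𝓗(L)` and of its orthogonal complement under rotations
  have hH : ∀ (a : AddCircle L), ∀ u ∈ zetaCycleSpace L, rotateLp L a u ∈ zetaCycleSpace L :=
    fun a _ hu => rotateLp_mem_zetaCycleSpace a hu
  have hH' : ∀ (a : AddCircle L), ∀ u ∈ (zetaCycleSpace L)ᗮ, rotateLp L a u ∈ (zetaCycleSpace L)ᗮ :=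
    fun a _ hu => rotateLp_mem_orthogonal (fun b _ hv => rotateLp_mem_zetaCycleSpace b hv) a hu
  -- Parseval: `⟪v, ξ⟫ = Σ_n ⟪v, e_n⟫ ⟪e_n, ξ⟫`, and every term vanishes
  have hsum := (fourierBasis (T := L)).hasSum_inner_mul_inner v ξ
  have hterm : ∀ n : ℤ, inner ℂ v ((fourierBasis (T := L)) n) * inner ℂ ((fourierBasis (T := L)) n) ξ = 0 := by
    intro n
    rw [coe_fourierBasis]
    by_cases hn : (fourierLp 2 n : Lp ℂ 2 (@haarAddCircle L hL)) ∈ zetaCycleSpace L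
    · -- `e_n ∈ 𝓗(L)`: `ζ(½ + i s_n) = 0`, so `⟪e_n, ξ⟫ = 0`
      have hsL : 2 * Real.pi * n / L * L = 2 * Real.pi * n := div_mul_cancel₀ _ hL.out.ne'
      have hzeta := CC2023_thm_6_4_i_holds L _ ⟨n, hsL, hn⟩
      rw [hf.inner_fourierLp_eq hξ hsL, hzeta, zero_mul, map_zero, smul_zero, mul_zero]
    · -- `e_n ∉ 𝓗(L)`: `⟪e_n, v⟫ = 0`
      have h := inner_fourierLp_eq_zero_of_not_mem (zetaCycleSpace L) hH hH' hn hv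
      rw [← inner_conj_symm, h, map_zero, zero_mul]
  have hzero : HasSum (fun n : ℤ => inner ℂ v ((fourierBasis (T := L)) n) * inner ℂ ((fourierBasis (T := L)) n) ξ)
      0 := by
    have h : (fun n : ℤ => inner ℂ v ((fourierBasis (T := L)) n) * inner ℂ ((fourierBasis (T := L)) n) ξ) =
        fun _ => 0 := funext hterm
    rw [h]
    exact hasSum_zero
  exact hsum.unique hzero

end Literature.NumberTheory.ConnesConsani2023.ZetaCycles
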